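import Summits.PneNP.PneNP.Theorems.PhaseTwinsMacroscopicTwinsAboveDefs

/-!
# Route PhaseTwins, item `MacroscopicTwinsAbove` (stmt-PneNP-2720): the degree-3 conflict-gadget graphs
# (definitions for the unconditional high-activity regime)

The item `MacroscopicTwinsAbove` asks, for `Δ ≥ 3` and `λ > λ_c(Δ)`, for `C^k`-twins of maximum degree `≤ Δ` whose
hard-core partition functions differ by a factor `e^{δn}`. Its "known in substance" half — very large activity —
needs no phase gadget: it suffices to have, for every `k`, two `C^k`-equivalent graphs of maximum degree THREE whose
INDEPENDENCE NUMBERS differ by a constant fraction of the number of vertices, since `λ^{α(G)} ≤ Z_G(λ) ≤ 2^n λ^{α(G)}`.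
This file defines such graphs (objects posited by the prover, not by the route): the FGLSS conflict graph of a 3-XOR
system `E : Fin m → Fin 3 → Fin nv` with right-hand side `c` (a vertex for each equation `e` and each of the four
satisfying assignments of `e`, encoded by its two free bits `S : Fin 2 → ZMod 2`, the third being
`CFIMatching.bit (c e) S 2`; conflict edges between assignments giving different values to a shared variable), with
its degree reduced to `3` by EXACT independence-number surgery:

* every conflict-graph vertex `(e, S)` is split into a PATH of `3D + 3` slot vertices alternating with `3D + 2`
  connector vertices (vertex splitting raises `α` by exactly one per connector); slot `σ` decodes
  (`slotKind`) to `(i, 0)` — the same-equation slot of direction `i : Fin 3` — or to `(i, ℓ + 1)` — the cross slot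
  for position `i` and occurrence label `ℓ : Fin D`;
* the same-equation conflict between `(e, S)` and `(e, S + dvec i)` is the edge between their two slots `(i, 0)`;
* the cross slot `(i, ℓ)` of `(e, S)` carries a FORK `slot — a — b` (a fork raises `α` by exactly one), and the
  conflict between `(e, S)` and `(e', S')` through the shared variable `E e i = E e' i'` with `loc (e', i') = ℓ'`,
  `loc (e, i) = ℓ` and different bits is the edge `b(e, S, i, ℓ') — b(e', S', i', ℓ)`.

All piece indices are invariant under the gauge action `S ↦ S + (f (E e 0), f (E e 1))` of an assignment
`f : Fin nv → ZMod 2`, so Duplicator's strategy (`ckEquiv_of_consistencyFamily`) transfers verbatim, and the maximum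
degree is `3`. Objects: `CGPiece`, `CGVert`, `slotKind`, `dvec`, `cgRel`/`cgGraph`, `cgShift`/`cgFlipFun`/`cgFlip`,
`cgData`, with their unfolding lemmas and `isLocalFlipAction_cgFlip`, `card_CGVert`; the named vertices `vS`/`vC`/`vA`/`vB`,
`forkSlot`/`dirSlot` with the five kinds of generating edges, and the planted set `InPlanted`/`planted`. Sources: Feige–Goldwasser–Lovász–
Safra–Szegedy 1996 (conflict graph of a constraint system); Alimonti–Kann 2000 / Garey–Johnson 1979 (vertex splitting
to cubic graphs preserving the independence number up to an additive constant); Atserias–Dawar 2019 §5 (gauge-covariant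
FO-interpretations of 3-XOR). [folklore]
-/

noncomputable section

open scoped Classical BigOperators

namespace Summit.PneNP.PneNP.Theorems.MacroscopicTwinsAbove.HighActivity

open Finset
open Literature.ModelTheory.FiniteModelTheory (IsLocalFlipAction)
open Literature.ModelTheory.FiniteModelTheory.CFIMatching (bit)
open Summit.PneNP.PneNP.Cruxes.MacroscopicTwinsAbove.LiteralGadgetsCfiApparatus (lgScope)

-- `Summit.PneNP.PneNP.…` (summit = sub-problem name) trips the duplicate-namespace linter on every declaration.
set_option linter.dupNamespace false

variable {nv m D : ℕ}

/-! ## The construction -/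

/-- The pieces of the gadget replacing ONE conflict-graph vertex: `3D + 3` SLOTS (a path, in this order),
`3D + 2` CONNECTORS (connector `j` sits between slots `j` and `j + 1`), and for each cross slot `(i, ℓ)` the two
FORK vertices `a (i, ℓ)` and `b (i, ℓ)`. [folklore] -/
abbrev CGPiece (D : ℕ) : Type :=
  Fin (3 * D + 2 + 1) ⊕ Fin (3 * D + 2) ⊕ (Fin 3 × Fin D) ⊕ (Fin 3 × Fin D)

/-- Vertices of the conflict-gadget graph: (equation, two free bits of a satisfying assignment, piece). Uniform
in the system and in the right-hand side (one vertex type for both twins). [folklore] -/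
abbrev CGVert (m D : ℕ) : Type := Fin m × (Fin 2 → ZMod 2) × CGPiece D

/-- Decoding a slot index: slot `σ ↦ (i, 0)` is the same-equation slot of direction `i`, `σ ↦ (i, ℓ + 1)` the
cross slot of position `i` and occurrence label `ℓ`. [folklore] -/
def slotKind (D : ℕ) : Fin (3 * D + 2 + 1) ≃ Fin 3 × Fin (D + 1) :=
  (finCongr (by ring)).trans finProdFinEquiv.symm

/-- The three nonzero translations of the two free bits: `(1,0)`, `(0,1)`, `(1,1)`. [folklore] -/
def dvec (i : Fin 3) : Fin 2 → ZMod 2 :=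
  fun k => if i = 2 then 1 else if (i : ℕ) = (k : ℕ) then 1 else 0

/-- Generating adjacency of `cgGraph E loc c` (symmetrised by `SimpleGraph.fromRel`):
(connector–slot) connector `j` of `(e, S)` — slots `j.castSucc` and `j.succ` of `(e, S)`;
(slot–fork) cross slot `(i, ℓ)` of `(e, S)` — fork vertex `a (i, ℓ)` of `(e, S)`; (fork) `a (i, ℓ) — b (i, ℓ)`;
(same-equation conflict) slot `(i, 0)` of `(e, S)` — slot `(i, 0)` of `(e, S + dvec i)`;
(cross conflict) `b (i, ℓ')` of `(e, S)` — `b (i', ℓ)` of `(e', S')` whenever `E e' i' = E e i`, `loc (e', i') = ℓ'`,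
`loc (e, i) = ℓ` and the two assignments give the shared variable different values. [folklore] -/
def cgRel (E : Fin m → Fin 3 → Fin nv) (loc : Fin m × Fin 3 → Fin D) (c : Fin m → ZMod 2) :
    CGVert m D → CGVert m D → Prop
  | (e, S, .inr (.inl j)), (e', S', .inl σ) => e' = e ∧ S' = S ∧ (σ = j.castSucc ∨ σ = j.succ)
  | (e, S, .inl σ), (e', S', .inr (.inr (.inl π))) => e' = e ∧ S' = S ∧ slotKind D σ = (π.1, π.2.succ)
  | (e, S, .inr (.inr (.inl π))), (e', S', .inr (.inr (.inr π'))) => e' = e ∧ S' = S ∧ π' = π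
  | (e, S, .inl σ), (e', S', .inl σ') =>
      e' = e ∧ σ' = σ ∧ (slotKind D σ).2 = 0 ∧ S' = S + dvec (slotKind D σ).1
  | (e, S, .inr (.inr (.inr π))), (e', S', .inr (.inr (.inr π'))) =>
      E e' π'.1 = E e π.1 ∧ loc (e', π'.1) = π.2 ∧ loc (e, π.1) = π'.2 ∧ bit (c e) S π.1 ≠ bit (c e') S' π'.1
  | _, _ => False

/-- **The conflict-gadget graph** of the system `E`, the occurrence labelling `loc` and the right-hand side `c`.
[folklore] -/
def cgGraph (E : Fin m → Fin 3 → Fin nv) (loc : Fin m × Fin 3 → Fin D) (c : Fin m → ZMod 2) :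
    SimpleGraph (CGVert m D) :=
  SimpleGraph.fromRel (cgRel E loc c)

/-- Adjacency of `cgGraph`, unfolded. [folklore] -/
theorem cgGraph_adj (E : Fin m → Fin 3 → Fin nv) (loc : Fin m × Fin 3 → Fin D) (c : Fin m → ZMod 2)
    (x y : CGVert m D) :
    (cgGraph E loc c).Adj x y ↔ x ≠ y ∧ (cgRel E loc c x y ∨ cgRel E loc c y x) := by
  rfl

/-- The number of vertices: `4 m (12 D + 5)`. [folklore] -/
theorem card_CGVert (m D : ℕ) : Fintype.card (CGVert m D) = 4 * m * (12 * D + 5) := by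
  simp only [CGVert, CGPiece, Fintype.card_prod, Fintype.card_sum, Fintype.card_fin, Fintype.card_fun,
    ZMod.card]
  ring

/-! ## The gauge action -/

/-- The translation of the two free bits of equation `e` induced by an assignment `f`. [folklore] -/
def cgShift (E : Fin m → Fin 3 → Fin nv) (f : Fin nv → ZMod 2) (e : Fin m) : Fin 2 → ZMod 2 :=
  fun k => f (E e (Fin.castSucc k))

/-- The gauge action of an assignment `f` on the vertices: the piece index is never changed. [folklore] -/
def cgFlipFun (E : Fin m → Fin 3 → Fin nv) (f : Fin nv → ZMod 2) : CGVert m D → CGVert m D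
  | (e, S, p) => (e, S + cgShift E f e, p)

/-- The data of a vertex (the variables whose flips move it or its edges): the scope of its equation. [folklore] -/
def cgData (E : Fin m → Fin 3 → Fin nv) : CGVert m D → Finset (Fin nv)
  | (e, _, _) => lgScope E e

/-- Unfolding `cgFlipFun`. [folklore] -/
theorem cgFlipFun_apply (E : Fin m → Fin 3 → Fin nv) (f : Fin nv → ZMod 2) (e : Fin m) (S : Fin 2 → ZMod 2)
    (p : CGPiece D) : cgFlipFun E f (e, S, p) = (e, S + cgShift E f e, p) := rfl

/-- Unfolding `cgData`. [folklore] -/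
theorem cgData_apply (E : Fin m → Fin 3 → Fin nv) (e : Fin m) (S : Fin 2 → ZMod 2) (p : CGPiece D) :
    cgData E ((e, S, p) : CGVert m D) = lgScope E e := rfl

/-- The data of a vertex has at most three variables (`c₀ = 3` in `ckEquiv_of_consistencyFamily`). [folklore] -/
theorem card_cgData_le (E : Fin m → Fin 3 → Fin nv) (x : CGVert m D) : (cgData E x).card ≤ 3 := by
  obtain ⟨e, S, p⟩ := x
  simp only [cgData, lgScope]
  exact Finset.card_image_le.trans (by simp)

/-- Flips preserve the data. [folklore] -/
theorem cgData_cgFlipFun (E : Fin m → Fin 3 → Fin nv) (f : Fin nv → ZMod 2) (x : CGVert m D) :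
    cgData E (cgFlipFun E f x) = cgData E x := by
  obtain ⟨e, S, p⟩ := x
  rfl

/-- Flipping twice by the same assignment is the identity (`ZMod 2`). [folklore] -/
theorem cgFlipFun_cgFlipFun (E : Fin m → Fin 3 → Fin nv) (f : Fin nv → ZMod 2) (x : CGVert m D) :
    cgFlipFun E f (cgFlipFun E f x) = x := by
  obtain ⟨e, S, p⟩ := x
  have h2 : ∀ a : ZMod 2, a + a = 0 := by decide
  have h3 : cgShift E f e + cgShift E f e = 0 := funext fun i => h2 _
  simp only [cgFlipFun_apply, add_assoc, h3, add_zero]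

/-- **The flip** by `f` as a permutation of the vertices (an involution). [folklore] -/
def cgFlip (E : Fin m → Fin 3 → Fin nv) (f : Fin nv → ZMod 2) : CGVert m D ≃ CGVert m D :=
  Function.Involutive.toPerm (cgFlipFun E f) (cgFlipFun_cgFlipFun E f)

/-- Unfolding `cgFlip`. [folklore] -/
theorem cgFlip_apply (E : Fin m → Fin 3 → Fin nv) (f : Fin nv → ZMod 2) (x : CGVert m D) :
    cgFlip E f x = cgFlipFun E f x := rfl

/-- The flips form a LOCAL FLIP ACTION for the data map `cgData` (input of `ckEquiv_of_consistencyFamily`): the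
image of a vertex depends only on `f` restricted to its data, and flips preserve data. [folklore] -/
theorem isLocalFlipAction_cgFlip (E : Fin m → Fin 3 → Fin nv) :
    IsLocalFlipAction (cgData (D := D) E) (cgFlip E) := by
  refine ⟨fun f g x hfg => ?_, fun f x => cgData_cgFlipFun E f x⟩
  obtain ⟨e, S, p⟩ := x
  rw [cgFlip_apply, cgFlip_apply, cgFlipFun_apply, cgFlipFun_apply]
  have hs : cgShift E f e = cgShift E g e := by
    funext k
    exact hfg _ (by simp only [cgData, lgScope]; exact Finset.mem_image_of_mem _ (Finset.mem_univ _))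
  rw [hs]

/-! ## Small facts about the directions and the slots -/

/-- The three directions are nonzero. [folklore] -/
theorem dvec_ne_zero (i : Fin 3) : dvec i ≠ 0 := by
  intro h
  fin_cases i
  · exact absurd (congr_fun h 0) (by decide)
  · exact absurd (congr_fun h 1) (by decide)
  · exact absurd (congr_fun h 0) (by decide)

/-- Every nonzero translation of the two free bits is one of the three directions. [folklore] -/
theorem exists_dvec_eq {d : Fin 2 → ZMod 2} (hd : d ≠ 0) : ∃ i : Fin 3, dvec i = d := by
  have h0 : ∀ a : ZMod 2, a = 0 ∨ a = 1 := by decide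
  have hext : ∀ d' : Fin 2 → ZMod 2, d' 0 = d 0 → d' 1 = d 1 → d' = d := by
    intro d' h0' h1'
    funext k
    fin_cases k
    · exact h0'
    · exact h1'
  rcases h0 (d 0) with ha | ha <;> rcases h0 (d 1) with hb | hb
  · exact absurd (hext 0 (by simp [ha]) (by simp [hb])).symm hd
  · exact ⟨1, hext _ (by simp [dvec, ha]) (by simp [dvec, hb])⟩
  · exact ⟨0, hext _ (by simp [dvec, ha]) (by simp [dvec, hb])⟩
  · exact ⟨2, hext _ (by simp [dvec, ha]) (by simp [dvec, hb])⟩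

/-- Translating twice by a direction is the identity. [folklore] -/
theorem add_dvec_add_dvec (S : Fin 2 → ZMod 2) (i : Fin 3) : S + dvec i + dvec i = S := by
  have h2 : ∀ a : ZMod 2, a + a = 0 := by decide
  rw [add_assoc]
  conv_rhs => rw [← add_zero S]
  congr 1
  funext k
  exact h2 _

/-- The four satisfying assignments of an equation with right-hand side `cw`: the represented bits sum to `cw`.
[folklore] -/
theorem sum_bit (cw : ZMod 2) (S : Fin 2 → ZMod 2) : bit cw S 0 + bit cw S 1 + bit cw S 2 = cw := by
  have h2 : ∀ a : ZMod 2, a + a = 0 := by decide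
  simp only [bit, Fin.reduceEq, ↓reduceIte, show (2 : Fin 3) ≠ 0 by decide, show (2 : Fin 3) ≠ 1 by decide]
  linear_combination h2 (S 0) + h2 (S 1)

/-- With right-hand side `0`, the assignment with free bits `0` represents the all-zero assignment. [folklore] -/
theorem bit_zero_zero (i : Fin 3) : bit 0 (0 : Fin 2 → ZMod 2) i = 0 := by
  simp only [bit, Pi.zero_apply, add_zero]
  split_ifs <;> rfl

/-! ## Named vertices, the generating edges, the planted set -/

section Named

/-- Slot `σ` of the conflict-graph vertex `(e, S)`. [folklore] -/
def vS (e : Fin m) (S : Fin 2 → ZMod 2) (σ : Fin (3 * D + 2 + 1)) : CGVert m D := (e, S, Sum.inl σ)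

/-- Connector `j` of `(e, S)` (between slots `j` and `j + 1`). [folklore] -/
def vC (e : Fin m) (S : Fin 2 → ZMod 2) (j : Fin (3 * D + 2)) : CGVert m D := (e, S, Sum.inr (Sum.inl j))

/-- Fork vertex `a π` of `(e, S)`. [folklore] -/
def vA (e : Fin m) (S : Fin 2 → ZMod 2) (π : Fin 3 × Fin D) : CGVert m D :=
  (e, S, Sum.inr (Sum.inr (Sum.inl π)))

/-- Fork vertex `b π` of `(e, S)` (the one carrying the cross-conflict edges). [folklore] -/
def vB (e : Fin m) (S : Fin 2 → ZMod 2) (π : Fin 3 × Fin D) : CGVert m D :=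
  (e, S, Sum.inr (Sum.inr (Sum.inr π)))

/-- The slot carrying the fork `π = (i, ℓ)`: the cross slot decoding to `(i, ℓ + 1)`. [folklore] -/
def forkSlot (D : ℕ) (π : Fin 3 × Fin D) : Fin (3 * D + 2 + 1) := (slotKind D).symm (π.1, π.2.succ)

/-- The same-equation slot of direction `i`: the slot decoding to `(i, 0)`. [folklore] -/
def dirSlot (D : ℕ) (i : Fin 3) : Fin (3 * D + 2 + 1) := (slotKind D).symm (i, 0)

variable (E : Fin m → Fin 3 → Fin nv) (loc : Fin m × Fin 3 → Fin D) (c : Fin m → ZMod 2)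

/-- Connector `j` is adjacent to slot `j`. [folklore] -/
theorem adj_vC_castSucc (e : Fin m) (S : Fin 2 → ZMod 2) (j : Fin (3 * D + 2)) :
    (cgGraph E loc c).Adj (vC e S j) (vS e S j.castSucc) := by
  rw [cgGraph_adj]
  exact ⟨by simp [vC, vS], Or.inl (by simp [vC, vS, cgRel])⟩

/-- Connector `j` is adjacent to slot `j + 1`. [folklore] -/
theorem adj_vC_succ (e : Fin m) (S : Fin 2 → ZMod 2) (j : Fin (3 * D + 2)) :
    (cgGraph E loc c).Adj (vC e S j) (vS e S j.succ) := by
  rw [cgGraph_adj]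
  exact ⟨by simp [vC, vS], Or.inl (by simp [vC, vS, cgRel])⟩

/-- The cross slot of `π` is adjacent to the fork vertex `a π`. [folklore] -/
theorem adj_forkSlot_vA (e : Fin m) (S : Fin 2 → ZMod 2) (π : Fin 3 × Fin D) :
    (cgGraph E loc c).Adj (vS e S (forkSlot D π)) (vA e S π) := by
  rw [cgGraph_adj]
  exact ⟨by simp [vA, vS], Or.inl (by simp [vA, vS, cgRel, forkSlot])⟩

/-- The two fork vertices are adjacent. [folklore] -/
theorem adj_vA_vB (e : Fin m) (S : Fin 2 → ZMod 2) (π : Fin 3 × Fin D) :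
    (cgGraph E loc c).Adj (vA e S π) (vB e S π) := by
  rw [cgGraph_adj]
  exact ⟨by simp [vA, vB], Or.inl (by simp [vA, vB, cgRel])⟩

/-- The same-equation conflict edge of direction `i`. [folklore] -/
theorem adj_dirSlot (e : Fin m) (S : Fin 2 → ZMod 2) (i : Fin 3) :
    (cgGraph E loc c).Adj (vS e S (dirSlot D i)) (vS e (S + dvec i) (dirSlot D i)) := by
  rw [cgGraph_adj]
  refine ⟨?_, Or.inl ?_⟩
  · simp only [vS, ne_eq, Prod.mk.injEq, true_and, and_true]
    intro h
    exact dvec_ne_zero i (add_left_cancel (a := S) (by rw [add_zero]; exact h.symm))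
  · simp [vS, cgRel, dirSlot]

/-- The cross-conflict edge: two conflict-graph vertices giving different values to a shared variable.
[folklore] -/
theorem adj_vB_vB {e e' : Fin m} {S S' : Fin 2 → ZMod 2} {i i' : Fin 3} (hx : E e' i' = E e i)
    (hne : bit (c e) S i ≠ bit (c e') S' i') :
    (cgGraph E loc c).Adj (vB e S (i, loc (e', i'))) (vB e' S' (i', loc (e, i))) := by
  rw [cgGraph_adj]
  refine ⟨?_, Or.inl ⟨hx, rfl, rfl, hne⟩⟩
  simp only [vB, ne_eq, Prod.mk.injEq, Sum.inr.injEq, not_and]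
  rintro rfl rfl rfl -
  exact hne rfl

end Named

/-- Membership in the PLANTED independent set of `cgGraph E loc 0`: the gadget of `(e, 0)` (the all-zero
assignment) is picked — its slots and `b`-vertices —, every other gadget contributes its connectors and
`a`-vertices. [folklore] -/
def InPlanted : CGVert m D → Prop
  | (_, S, .inl _) => S = 0
  | (_, S, .inr (.inl _)) => S ≠ 0
  | (_, S, .inr (.inr (.inl _))) => S ≠ 0
  | (_, S, .inr (.inr (.inr _))) => S = 0

/-- The planted independent set. [folklore] -/
def planted (m D : ℕ) : Finset (CGVert m D) := Finset.univ.filter fun x => InPlanted x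

end Summit.PneNP.PneNP.Theorems.MacroscopicTwinsAbove.HighActivity
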